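import Summits.QuantumAdvantage.QuantumAdvantage.Theorems.WhiteBoxWalkWbwVerifiableLineNoSpeedupCycleSurgeryDefs
import Summits.QuantumAdvantage.QuantumAdvantage.Theorems.WhiteBoxWalkWbwVerifiableLineNoSpeedupCycleSurgeryAdversaryDefs
import Summits.QuantumAdvantage.QuantumAdvantage.Theorems.WhiteBoxWalkWbwVerifiableLineNoSpeedupCycleSurgeryAnatomy

/-!
# Crux `WhiteBoxWalk.WbwVerifiableLineNoSpeedup` (stmt-QuantumAdvantage-2239), line
`cycle-surgery-adversary` — stub `stub_pairProducts`: Ambainis's per-pair per-bit products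

For every pair `(t, t') = (permInstance S, permInstance S')` of the cycle-surgery relation `rel m T`
and every input position `i` with `t i ≠ t' i`, the product of the partner counts
`leftCount (rel m T) t i * rightCount (rel m T) t' i` is at most
`Lstar m T = max (N², 4 · hid² · N)`, `N = 2^m` [A. Ambainis, *Quantum lower bounds by quantum
arguments*, JCSS 64 (2002), Thm. 6 — the hypothesis `l_{x,i} · l_{y,i} ≤ l_max`]. The count: decode
`i` (`svlIndex_cases`); at an S-table bit of row `x` a partner `S * swap(x_k, w)` differing there
has `x ∈ {x_k, w}`, so it is `S * swap(x, w')` — at most `N` on either side; at a V-table cell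
`(x, l)` the side marking the cell has at most `hid · N` partners at all, and on the other side a
partner marking it is `S * swap(x_k, S^{-(l-k)} x)`, one per cut (`IsSurgery.anatomy`) — at most
`hid`. Right-hand counts reduce to left-hand ones by `IsSurgery.symm`. Sorry-free; uses only the
lead's Defs / AdversaryDefs / Anatomy modules. -/

noncomputable section

set_option linter.dupNamespace false

namespace Summit.QuantumAdvantage.QuantumAdvantage.Theorems.WbwVerifiableLineNoSpeedup.CycleSurgery

open Literature.Computability.Cryptography Literature.Computability.QuantumComplexity

/-! ## §5 Per-pair per-bit products of the surgery relation (`stub_pairProducts`)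

For a related pair `(t, t') = (permInstance S, permInstance S')` of `rel m T` and an input position
`i` where the two strings differ, Ambainis's product `l_{t,i} · l_{t',i}` is at most
`Lstar m T = max (N², 4 · hid² · N)`, `N = 2^m`. Decoding `i`: at an S-table bit of row `x`, a
partner `S * swap(x_k, w)` of `S` differing there has `x ∈ {x_k, w}`, i.e. it is `S * swap(x, w')`
for some `w'` — at most `N` partners on either side, product `≤ N²`; at a V-table cell `(x, l)`,
the side whose line passes through `x` at time `l` has at most `hid · N` partners at all, while on
the other side a partner marking the cell is `S * swap(x_k, S^{-(l-k)} x)` — one per cut `k`, at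
most `hid` — product `≤ hid² · N`. Right-hand counts reduce to left-hand ones through
`IsSurgery.symm`. -/

section PairProducts

variable {m T : ℕ}

/-! ### Decoding input positions -/

/-- Every input position is an S-table bit `(x, j)` or a V-table cell `(x, l)`. -/
theorem svlIndex_cases (i : Fin (2 ^ m * m + 2 ^ m * (T + 1))) :
    (∃ (x : Fin (2 ^ m)) (j : Fin m), i = svlSuccIndex m T x j) ∨
      ∃ (x : Fin (2 ^ m)) (l : Fin (T + 1)), i = svlVerifyIndex m T x l := by
  induction i using Fin.addCases with
  | left k =>
    refine Or.inl ⟨(finProdFinEquiv.symm k).1, (finProdFinEquiv.symm k).2, ?_⟩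
    rw [svlSuccIndex, Prod.mk.eta, Equiv.apply_symm_apply]
  | right k =>
    refine Or.inr ⟨(finProdFinEquiv.symm k).1, (finProdFinEquiv.symm k).2, ?_⟩
    rw [svlVerifyIndex, Prod.mk.eta, Equiv.apply_symm_apply]

/-- The bit of a permutation instance at the S-table position `(x, j)` is bit `j` of `S x`. -/
theorem permInstance_svlSuccIndex (S : Equiv.Perm (Fin (2 ^ m))) (x : Fin (2 ^ m)) (j : Fin m) :
    permInstance m T S (svlSuccIndex m T x j) = (S x).val.testBit j.val :=
  svlSuccBit_permInstance S x j

/-- The bit of a permutation instance at the V-table position `(x, l)` is `[x = x_l]`. -/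
theorem permInstance_svlVerifyIndex (S : Equiv.Perm (Fin (2 ^ m))) (x : Fin (2 ^ m))
    (l : Fin (T + 1)) : permInstance m T S (svlVerifyIndex m T x l) = decide (x = pt S l.val) :=
  svlVerify_permInstance S x l

/-- Two permutation instances that differ at an S-table bit of row `x` have different rows `x`. -/
theorem apply_ne_of_permInstance_svlSuccIndex_ne {S S₂ : Equiv.Perm (Fin (2 ^ m))} {x : Fin (2 ^ m)}
    {j : Fin m}
    (h : permInstance m T S (svlSuccIndex m T x j) ≠ permInstance m T S₂ (svlSuccIndex m T x j)) :
    S₂ x ≠ S x := by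
  rw [permInstance_svlSuccIndex, permInstance_svlSuccIndex] at h
  intro hx
  exact h (by rw [hx])

/-- Two permutation instances that differ at the V-table cell `(x, l)`, the first NOT marking it
(`x ≠ x_l`), the second marks it: its line visits `x` at time `l`. -/
theorem pt_eq_of_permInstance_svlVerifyIndex_ne {S S₂ : Equiv.Perm (Fin (2 ^ m))} {x : Fin (2 ^ m)}
    {l : Fin (T + 1)} (hx : x ≠ pt S l.val)
    (h : permInstance m T S (svlVerifyIndex m T x l) ≠
      permInstance m T S₂ (svlVerifyIndex m T x l)) : pt S₂ l.val = x := by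
  by_contra hc
  apply h
  rw [permInstance_svlVerifyIndex, permInstance_svlVerifyIndex, decide_eq_false hx,
    decide_eq_false (Ne.symm hc)]

/-! ### The shape of a surgery partner -/

/-- Every surgery partner of `S` is `S * swap(x_k, w)` with `(k, w) ∈ [pre, T) × {0,1}ᵐ`. -/
theorem IsSurgery.exists_mem_product {S S₂ : Equiv.Perm (Fin (2 ^ m))} (h : IsSurgery m T S S₂) :
    ∃ kv ∈ Finset.Ico (pre m T) T ×ˢ (Finset.univ : Finset (Fin (2 ^ m))),
      S₂ = S * Equiv.swap (pt S kv.1) kv.2 := by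
  obtain ⟨-, -, k, hk, hkT, v, -, rfl⟩ := h
  exact ⟨(k, v), Finset.mem_product.2 ⟨Finset.mem_Ico.2 ⟨hk, hkT⟩, Finset.mem_univ _⟩, rfl⟩

/-- A surgery partner of `S` that differs from `S` at row `x` is `S * swap(x, w)` for some `w`
(the differing row is the cut point or the vertex of the surgery, and `swap` is symmetric). -/
theorem IsSurgery.exists_eq_mul_swap {S S₂ : Equiv.Perm (Fin (2 ^ m))} (h : IsSurgery m T S S₂)
    {x : Fin (2 ^ m)} (hx : S₂ x ≠ S x) : ∃ w : Fin (2 ^ m), S₂ = S * Equiv.swap x w := by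
  obtain ⟨-, -, k, -, -, v, -, rfl⟩ := h
  rcases eq_or_eq_of_surgery_apply_ne S hx with rfl | rfl
  · exact ⟨v, rfl⟩
  · exact ⟨pt S k, by rw [Equiv.swap_comm]⟩

/-- A surgery partner of `S` whose line visits at a time `l ≤ T` a vertex `x ≠ x_l` is
`S * swap(x_k, S^{-(l-k)} x)` for some cut `k ∈ [pre, T)` (by the anatomy of the surgery its line
beyond the cut `k < l` is `S^(l-k) v`): at most ONE such partner per cut. -/
theorem IsSurgery.exists_mem_Ico {S S₂ : Equiv.Perm (Fin (2 ^ m))} (h : IsSurgery m T S S₂)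
    {x : Fin (2 ^ m)} {l : ℕ} (hl : l ≤ T) (hxS : x ≠ pt S l) (hx₂ : pt S₂ l = x) :
    ∃ k ∈ Finset.Ico (pre m T) T, S₂ = S * Equiv.swap (pt S k) ((S ^ (l - k)).symm x) := by
  obtain ⟨k, hk, hkT, v, -, hS₂, hagree, htail⟩ := h.anatomy
  refine ⟨k, Finset.mem_Ico.2 ⟨hk, hkT⟩, ?_⟩
  have hkl : k < l := by
    by_contra hkl
    exact hxS (by rw [← hx₂, hagree l (Nat.le_of_not_lt hkl)])
  have hv : (S ^ (l - k)).symm x = v := by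
    rw [Equiv.symm_apply_eq, ← hx₂]
    exact (htail l hkl hl).1
  rw [hv]
  exact hS₂

/-! ### Counting partners -/

/-- Bounding a left count by a finset containing all the counted pairs. -/
theorem leftCount_le_card {n : ℕ} {R : Finset ((Fin n → Bool) × (Fin n → Bool))}
    {x : Fin n → Bool} {i : Fin n} (s : Finset ((Fin n → Bool) × (Fin n → Bool)))
    (h : ∀ q ∈ R, q.1 = x → q.1 i ≠ q.2 i → q ∈ s) : leftCount R x i ≤ s.card := by
  unfold leftCount
  refine Finset.card_le_card fun q hq => ?_
  rw [Finset.mem_filter] at hq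
  exact h q hq.1 hq.2.1 hq.2.2

/-- Bounding a right count by a finset containing all the counted pairs. -/
theorem rightCount_le_card {n : ℕ} {R : Finset ((Fin n → Bool) × (Fin n → Bool))}
    {y : Fin n → Bool} {i : Fin n} (s : Finset ((Fin n → Bool) × (Fin n → Bool)))
    (h : ∀ q ∈ R, q.2 = y → q.1 i ≠ q.2 i → q ∈ s) : rightCount R y i ≤ s.card := by
  unfold rightCount
  refine Finset.card_le_card fun q hq => ?_
  rw [Finset.mem_filter] at hq
  exact h q hq.1 hq.2.1 hq.2.2

/-- All the left partners of an instance: at most `hid · 2^m` (cut and vertex). -/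
theorem leftCount_le_hid_mul (S : Equiv.Perm (Fin (2 ^ m)))
    (i : Fin (2 ^ m * m + 2 ^ m * (T + 1))) :
    leftCount (rel m T) (permInstance m T S) i ≤ hid m T * 2 ^ m := by
  classical
  refine (leftCount_le_card
    ((Finset.Ico (pre m T) T ×ˢ (Finset.univ : Finset (Fin (2 ^ m)))).image fun kv =>
      (permInstance m T S, permInstance m T (S * Equiv.swap (pt S kv.1) kv.2)))
    fun q hq hq1 _ => ?_).trans (Finset.card_image_le.trans ?_)
  · obtain ⟨S₁, S₂, hsur, -, -, rfl⟩ := mem_rel.1 hq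
    obtain rfl : S₁ = S := permInstance_injective hq1
    obtain ⟨kv, hkv, rfl⟩ := hsur.exists_mem_product
    exact Finset.mem_image.2 ⟨kv, hkv, rfl⟩
  · rw [Finset.card_product, Nat.card_Ico, Finset.card_univ, Fintype.card_fin]
    have := pre_add_hid m T
    rw [show T - pre m T = hid m T by omega]

/-- All the right partners of an instance: at most `hid · 2^m` (through `IsSurgery.symm`). -/
theorem rightCount_le_hid_mul (S' : Equiv.Perm (Fin (2 ^ m)))
    (i : Fin (2 ^ m * m + 2 ^ m * (T + 1))) :
    rightCount (rel m T) (permInstance m T S') i ≤ hid m T * 2 ^ m := by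
  classical
  refine (rightCount_le_card
    ((Finset.Ico (pre m T) T ×ˢ (Finset.univ : Finset (Fin (2 ^ m)))).image fun kv =>
      (permInstance m T (S' * Equiv.swap (pt S' kv.1) kv.2), permInstance m T S'))
    fun q hq hq2 _ => ?_).trans (Finset.card_image_le.trans ?_)
  · obtain ⟨S₃, S₁, hsur, -, -, rfl⟩ := mem_rel.1 hq
    obtain rfl : S₁ = S' := permInstance_injective hq2
    obtain ⟨kv, hkv, rfl⟩ := hsur.symm.exists_mem_product
    exact Finset.mem_image.2 ⟨kv, hkv, rfl⟩
  · rw [Finset.card_product, Nat.card_Ico, Finset.card_univ, Fintype.card_fin]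
    have := pre_add_hid m T
    rw [show T - pre m T = hid m T by omega]

/-- An S-table bit of row `x`: at most `2^m` left partners differ there (`S * swap(x, w)`). -/
theorem leftCount_svlSuccIndex_le (S : Equiv.Perm (Fin (2 ^ m))) (x : Fin (2 ^ m)) (j : Fin m) :
    leftCount (rel m T) (permInstance m T S) (svlSuccIndex m T x j) ≤ 2 ^ m := by
  classical
  refine (leftCount_le_card
    ((Finset.univ : Finset (Fin (2 ^ m))).image fun w =>
      (permInstance m T S, permInstance m T (S * Equiv.swap x w)))
    fun q hq hq1 hne => ?_).trans (Finset.card_image_le.trans (by simp))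
  obtain ⟨S₁, S₂, hsur, -, -, rfl⟩ := mem_rel.1 hq
  obtain rfl : S₁ = S := permInstance_injective hq1
  obtain ⟨w, rfl⟩ := hsur.exists_eq_mul_swap (apply_ne_of_permInstance_svlSuccIndex_ne hne)
  exact Finset.mem_image.2 ⟨w, Finset.mem_univ _, rfl⟩

/-- An S-table bit of row `x`: at most `2^m` right partners differ there (`S' * swap(x, w)`). -/
theorem rightCount_svlSuccIndex_le (S' : Equiv.Perm (Fin (2 ^ m))) (x : Fin (2 ^ m)) (j : Fin m) :
    rightCount (rel m T) (permInstance m T S') (svlSuccIndex m T x j) ≤ 2 ^ m := by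
  classical
  refine (rightCount_le_card
    ((Finset.univ : Finset (Fin (2 ^ m))).image fun w =>
      (permInstance m T (S' * Equiv.swap x w), permInstance m T S'))
    fun q hq hq2 hne => ?_).trans (Finset.card_image_le.trans (by simp))
  obtain ⟨S₃, S₁, hsur, -, -, rfl⟩ := mem_rel.1 hq
  obtain rfl : S₁ = S' := permInstance_injective hq2
  obtain ⟨w, rfl⟩ :=
    hsur.symm.exists_eq_mul_swap (apply_ne_of_permInstance_svlSuccIndex_ne hne.symm)
  exact Finset.mem_image.2 ⟨w, Finset.mem_univ _, rfl⟩

/-- A V-table cell `(x, l)` NOT marked by `S` (`x ≠ x_l`): at most `hid` left partners mark it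
(one per cut). -/
theorem leftCount_svlVerifyIndex_le (S : Equiv.Perm (Fin (2 ^ m))) {x : Fin (2 ^ m)}
    {l : Fin (T + 1)} (hx : x ≠ pt S l.val) :
    leftCount (rel m T) (permInstance m T S) (svlVerifyIndex m T x l) ≤ hid m T := by
  classical
  refine (leftCount_le_card
    ((Finset.Ico (pre m T) T).image fun k =>
      (permInstance m T S, permInstance m T (S * Equiv.swap (pt S k) ((S ^ (l.val - k)).symm x))))
    fun q hq hq1 hne => ?_).trans (Finset.card_image_le.trans ?_)
  · obtain ⟨S₁, S₂, hsur, -, -, rfl⟩ := mem_rel.1 hq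
    obtain rfl : S₁ = S := permInstance_injective hq1
    obtain ⟨k, hk, rfl⟩ := hsur.exists_mem_Ico (Nat.le_of_lt_succ l.isLt) hx
      (pt_eq_of_permInstance_svlVerifyIndex_ne hx hne)
    exact Finset.mem_image.2 ⟨k, hk, rfl⟩
  · rw [Nat.card_Ico]
    have := pre_add_hid m T
    omega

/-- A V-table cell `(x, l)` NOT marked by `S'` (`x ≠ x'_l`): at most `hid` right partners mark it
(one per cut, through `IsSurgery.symm`). -/
theorem rightCount_svlVerifyIndex_le (S' : Equiv.Perm (Fin (2 ^ m))) {x : Fin (2 ^ m)}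
    {l : Fin (T + 1)} (hx : x ≠ pt S' l.val) :
    rightCount (rel m T) (permInstance m T S') (svlVerifyIndex m T x l) ≤ hid m T := by
  classical
  refine (rightCount_le_card
    ((Finset.Ico (pre m T) T).image fun k =>
      (permInstance m T (S' * Equiv.swap (pt S' k) ((S' ^ (l.val - k)).symm x)),
        permInstance m T S'))
    fun q hq hq2 hne => ?_).trans (Finset.card_image_le.trans ?_)
  · obtain ⟨S₃, S₁, hsur, -, -, rfl⟩ := mem_rel.1 hq
    obtain rfl : S₁ = S' := permInstance_injective hq2
    obtain ⟨k, hk, rfl⟩ := hsur.symm.exists_mem_Ico (Nat.le_of_lt_succ l.isLt) hx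
      (pt_eq_of_permInstance_svlVerifyIndex_ne hx hne.symm)
    exact Finset.mem_image.2 ⟨k, hk, rfl⟩
  · rw [Nat.card_Ico]
    have := pre_add_hid m T
    omega

end PairProducts

/-- **stub_pairProducts** — for every pair of `rel m T` and every input bit where the two instances
differ, the Ambainis product is `≤ Lstar m T = max (N², 4 hid² N)`: at an S-table bit each side has
at most `N = 2^m` partners differing there; at a V-table cell the marked side has at most `hid · N`
partners at all and the unmarked side acquires the mark under at most `hid` partners (one vertex per
cut, by the anatomy of the surgery); right-hand counts via `IsSurgery.symm`. (The numeric hypotheses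
of the registered signature are not needed.) -/
theorem stub_pairProducts :
    ∀ m T : ℕ, 4 ≤ m → 1 ≤ T → T + 1 ≤ 2 ^ (m - 1) → ProductBound (rel m T) (Lstar m T) := by
  intro m T _ _ _ p hp i hne
  obtain ⟨S, S', -, -, -, rfl⟩ := mem_rel.1 hp
  dsimp only at hne ⊢
  rcases svlIndex_cases i with ⟨x, j, rfl⟩ | ⟨x, l, rfl⟩
  · -- an S-table bit: `≤ N` partners on either side
    have ha : (leftCount (rel m T) (permInstance m T S) (svlSuccIndex m T x j) : ℝ) ≤ 2 ^ m := by
      exact_mod_cast leftCount_svlSuccIndex_le S x j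
    have hb : (rightCount (rel m T) (permInstance m T S') (svlSuccIndex m T x j) : ℝ) ≤ 2 ^ m := by
      exact_mod_cast rightCount_svlSuccIndex_le S' x j
    calc _ ≤ (2 : ℝ) ^ m * 2 ^ m := mul_le_mul ha hb (Nat.cast_nonneg _) (by positivity)
      _ ≤ Lstar m T := by unfold Lstar; exact le_max_left _ _
  · -- a V-table cell: marked side `≤ hid · N`, unmarked side `≤ hid`
    have key : leftCount (rel m T) (permInstance m T S) (svlVerifyIndex m T x l) *
        rightCount (rel m T) (permInstance m T S') (svlVerifyIndex m T x l) ≤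
          hid m T * 2 ^ m * hid m T := by
      by_cases hx : x = pt S l.val
      · have hx' : x ≠ pt S' l.val := by
          intro h'
          apply hne
          rw [permInstance_svlVerifyIndex, permInstance_svlVerifyIndex, decide_eq_true hx,
            decide_eq_true h']
        exact Nat.mul_le_mul (leftCount_le_hid_mul S _) (rightCount_svlVerifyIndex_le S' hx')
      · calc _ ≤ hid m T * (hid m T * 2 ^ m) :=
              Nat.mul_le_mul (leftCount_svlVerifyIndex_le S hx) (rightCount_le_hid_mul S' _)
          _ = hid m T * 2 ^ m * hid m T := by ring
    have key' : (leftCount (rel m T) (permInstance m T S) (svlVerifyIndex m T x l) : ℝ) *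
        rightCount (rel m T) (permInstance m T S') (svlVerifyIndex m T x l) ≤
          hid m T * 2 ^ m * hid m T := by
      exact_mod_cast key
    calc _ ≤ (hid m T : ℝ) * 2 ^ m * hid m T := key'
      _ = (hid m T : ℝ) ^ 2 * 2 ^ m := by ring
      _ ≤ 4 * ((hid m T : ℝ) ^ 2 * 2 ^ m) := le_mul_of_one_le_left (by positivity) (by norm_num)
      _ = 4 * (hid m T : ℝ) ^ 2 * 2 ^ m := by ring
      _ ≤ Lstar m T := by unfold Lstar; exact le_max_right _ _

end Summit.QuantumAdvantage.QuantumAdvantage.Theorems.WbwVerifiableLineNoSpeedup.CycleSurgery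

end
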